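import Literature.AlgebraicTopology.SingularHomology.BoundaryComplementHomology
import Literature.AlgebraicTopology.SingularHomology.DeformationRetractHomology
import HarnessLib

/-!
# Classes of `Hₙ(X, V)` are detected by their localisations at finitely many disjoint closed sets

Topic `Literature/AlgebraicTopology/SingularHomology`; third brick for the fact seat
`provefact-Literature.Topology.FourManifolds.Cobordism.Milnor1965_exists_isolatedPair_middle`
(one-slide step of Milnor's Basis Theorem 7.6 on a slab, *Lectures on the h-cobordism theorem*
(1965), PDF pp. 50–52).  Milnor reads off the class of a `k`-disc `D` in `Hₖ(W, V)` from the
intersection numbers with the right-hand discs `D_R(p₁), …, D_R(p_k)` (PDF p. 50: *"Thus `D`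
represents the element `Σⱼ (D_R(p_j) · D) b_j`"*); homologically: **a class of `Hₖ(W, V)` is
determined by its images in the local homology groups `Hₖ(W | D_R(p_j)) = Hₖ(W, W ∖ D_R(p_j))`**,
because the complement of the right-hand discs deformation retracts onto `V` along the
trajectories.  This file proves the topological half of that statement (A. Hatcher, *Algebraic
Topology* (2002), §2.1 p. 118, exact sequence of a triple; §2.2 p. 152 / §3.3 Lemma 3.27, the
relative Mayer–Vietoris sequence of `H⁎(X | ·)`, in the tree as `clocalHomology.mv_exact₁`):

* `relativeSingularHomology.mono_map_id_of_isZero` — `Hₙ(X, V) → Hₙ(X, W)` is injective for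
  `V ⊆ W` with `Hₙ(W, V) = 0` (e.g. `V` a strong deformation retract of `W`,
  `IsStrongDeformationRetractOf.isZero_relativeSingularHomology`);
* `localHomologyOfSet.eq_zero_of_restrictLocal_eq_zero_of_disjoint` — for disjoint closed `A`,
  `B`, a class of `Hₙ(X | A ∪ B)` restricting to `0` at `A` and at `B` is `0`;
* `localHomologyOfSet.eq_zero_of_forall_restrictLocal_eq_zero` — the same for a finite family
  of pairwise disjoint closed sets;
* **`relativeSingularHomology.eq_zero_of_forall_localisation_eq_zero`** — if `V ⊆ X ∖ ⋃ᵢ Kᵢ`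
  with `Hₙ(X ∖ ⋃ᵢ Kᵢ, V) = 0`, the `Kᵢ` finitely many pairwise disjoint closed sets, then a class
  of `Hₙ(X, V)` all of whose localisations in `Hₙ(X | Kᵢ)` vanish is zero.

Everything is proved; no definitions, no named facts.

## References

* J. Milnor, *Lectures on the h-cobordism theorem*, notes by L. Siebenmann and J. Sondow,
  Princeton Mathematical Notes (1965), proof of Thm. 7.6 (PDF p. 50).  Held:
  `lit read book:milnornd-lectures-h-cobordism-theorem`. [MilnorHCobordism1965]
* A. Hatcher, *Algebraic Topology*, CUP 2002, §2.1 p. 118, §2.2 p. 152, §3.3 Lemma 3.27.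
  [HatcherAT2002]
-/

noncomputable section

-- as in `LocalHomologyMayerVietoris`: chains of the concrete complex are `Finsupp`s up to unfolding
set_option backward.isDefEq.respectTransparency false

open CategoryTheory Limits Set Function

universe u v

namespace Literature.AlgebraicTopology.SingularHomology

variable (R : Type v) [CommRing R] (M : Type v) [AddCommGroup M] [Module R M]
variable {X : Type u} [TopologicalSpace X]

/-! ### Injectivity of `Hₙ(X, V) → Hₙ(X, W)` -/

namespace relativeSingularHomology

/-- **`Hₙ(X, V) → Hₙ(X, W)` is a monomorphism when `Hₙ(W, V) = 0`**, `V ⊆ W` (exactness of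
`Hₙ(W, V) → Hₙ(X, V) → Hₙ(X, W)` in the sequence of the triple, Hatcher 2002, §2.1 p. 118).
[cite: HatcherAT2002, §2.1, p. 118 (exact sequence of a triple)] -/
theorem mono_map_id_of_isZero {W V : Set X} (h : V ⊆ W) (n : ℕ)
    (hz : IsZero (relativeSingularHomology R M (↥W) (Subtype.val ⁻¹' V) n)) :
    Mono (map R M (ContinuousMap.id X) (mapsTo_id_of_subset h) n) :=
  (triple_exact₂ R M h n).mono_g (hz.eq_of_src _ _)

/-- Elementwise form: if `Hₙ(W, V) = 0` then a class of `Hₙ(X, V)` vanishing in `Hₙ(X, W)` is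
zero. [cite: HatcherAT2002, §2.1, p. 118 (exact sequence of a triple)] -/
theorem eq_zero_of_map_id_eq_zero {W V : Set X} (h : V ⊆ W) (n : ℕ)
    (hz : IsZero (relativeSingularHomology R M (↥W) (Subtype.val ⁻¹' V) n))
    {x : relativeSingularHomology R M X V n}
    (hx : map R M (ContinuousMap.id X) (mapsTo_id_of_subset h) n x = 0) : x = 0 := by
  haveI := mono_map_id_of_isZero R M h n hz
  exact (ModuleCat.mono_iff_injective (map R M (ContinuousMap.id X) (mapsTo_id_of_subset h) n)).1
    inferInstance (hx.trans (map_zero _).symm)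

end relativeSingularHomology

/-! ### Disjoint closed sets: `Hₙ(X | A ∪ B) ↪ Hₙ(X | A) × Hₙ(X | B)` -/

namespace localHomologyOfSet

/-- **For disjoint closed `A`, `B`, a class of `Hₙ(X | A ∪ B)` which restricts to zero at `A`
and at `B` is zero** (relative Mayer–Vietoris sequence, Hatcher 2002, §2.2 p. 152: the kernel
of `Hₙ(X | A ∪ B) → Hₙ(X | A) ⊕ Hₙ(X | B)` is the image of `Hₙ₊₁(X | A ∩ B) = Hₙ₊₁(X | ∅) = 0`).
[cite: HatcherAT2002, §2.2 p. 152] -/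
theorem eq_zero_of_restrictLocal_eq_zero_of_disjoint {A B : Set X} (hA : IsClosed A)
    (hB : IsClosed B) (hAB : Disjoint A B) (n : ℕ) {x : localHomologyOfSet R M X (A ∪ B) n}
    (hxA : restrictLocal R M (Set.subset_union_left : A ⊆ A ∪ B) n x = 0)
    (hxB : restrictLocal R M (Set.subset_union_right : B ⊆ A ∪ B) n x = 0) : x = 0 := by
  -- work in the concrete model
  apply (localHomologyOfSet.cmpIso R M X (A ∪ B) n).toLinearEquiv.injective
  rw [map_zero]
  set α := (localHomologyOfSet.cmpIso R M X (A ∪ B) n).toLinearEquiv x with hα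
  have hres : clocalHomology.mvRes R M A B n α = 0 := by
    rw [clocalHomology.mvRes_apply, Prod.mk_eq_zero, hα, Iso.toLinearEquiv_apply,
      res_cmpIso_hom_apply, res_cmpIso_hom_apply, hxA, hxB, map_zero, map_zero]
    exact ⟨rfl, rfl⟩
  obtain ⟨β, hβ⟩ := (clocalHomology.mv_exact₁ R M hA hB n α).1 hres
  have hz : IsZero (clocalHomology R M X (A ∩ B) (n + 1)) := by
    rw [Set.disjoint_iff_inter_eq_empty.1 hAB]
    exact isZero_clocalHomology_of_isZero R M (isZero_localHomologyOfSet_empty R M (n + 1))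
  haveI := ModuleCat.subsingleton_of_isZero hz
  rw [← hβ, Subsingleton.elim β 0, map_zero]

/-- **Finitely many pairwise disjoint closed sets: a class of `Hₙ(X | ⋃ᵢ Kᵢ)` restricting to zero
at every `Kᵢ` is zero** (induction on the family with the two-set case
`eq_zero_of_restrictLocal_eq_zero_of_disjoint`; Hatcher 2002, §2.2 p. 152 / §3.3 proof of
Lemma 3.27).  Stated for a set `S` given with an equation `S = ⋃ i ∈ s, K i`.
[cite: HatcherAT2002, §2.2 p. 152; §3.3 Lemma 3.27] -/
theorem eq_zero_of_forall_restrictLocal_eq_zero {ι : Type*} (K : ι → Set X)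
    (hK : ∀ i, IsClosed (K i)) (s : Finset ι)
    (hdisj : (s : Set ι).PairwiseDisjoint K) :
    ∀ (S : Set X) (hS : S = ⋃ i ∈ s, K i) (n : ℕ) (x : localHomologyOfSet R M X S n),
      (∀ i (hi : i ∈ s), restrictLocal R M (hS ▸ Set.subset_biUnion_of_mem hi : K i ⊆ S) n x = 0) →
        x = 0 := by
  classical
  induction s using Finset.induction_on with
  | empty =>
    intro S hS n x _
    simp only [Finset.notMem_empty, Set.iUnion_of_empty, Set.iUnion_empty] at hS
    subst hS
    haveI := ModuleCat.subsingleton_of_isZero (isZero_localHomologyOfSet_empty R M (X := X) n)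
    exact Subsingleton.elim x 0
  | insert a s ha ih =>
    intro S hS n x hx
    have hS' : S = K a ∪ ⋃ i ∈ s, K i := by rw [hS, Finset.set_biUnion_insert]
    have hdisj' : ((s : Set ι)).PairwiseDisjoint K :=
      hdisj.subset (by simp [Finset.coe_insert])
    have hAB : Disjoint (K a) (⋃ i ∈ s, K i) := by
      rw [Set.disjoint_iUnion₂_right]
      intro i hi
      exact hdisj (by simp) (by simp [Finset.mem_coe.1 hi]) (fun h => ha (h ▸ hi))
    have hB : IsClosed (⋃ i ∈ s, K i) := isClosed_biUnion_finset fun i _ => hK i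
    subst hS'
    refine eq_zero_of_restrictLocal_eq_zero_of_disjoint R M (hK a) hB hAB n ?_ ?_
    · exact hx a (Finset.mem_insert_self a s)
    · refine ih hdisj' _ rfl n _ fun i hi => ?_
      rw [← ModuleCat.comp_apply, restrictLocal_comp]
      exact hx i (Finset.mem_insert_of_mem hi)

end localHomologyOfSet

/-! ### Classes of `Hₙ(X, V)` are detected at finitely many disjoint closed sets -/

namespace relativeSingularHomology

/-- **A relative class is determined by its localisations** (Milnor 1965, PDF p. 50, in
homological form; Hatcher 2002, §2.1 p. 118 and §2.2 p. 152).  The **localisation at `K`** of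
relative classes, `Hₙ(X, V) → Hₙ(X | K) = Hₙ(X, X ∖ K)` for `V ⊆ X ∖ K`, is the map induced by the
map of pairs `(X, V) → (X, X ∖ K)` (`mapsTo_id_of_subset`).  Let `K₁, …, K_m` be pairwise
disjoint closed subsets of `X` (a finite family `K` over `s`), `U = X ∖ ⋃ᵢ Kᵢ`, and `V ⊆ U`
with `Hₙ(U, V) = 0` — e.g. `V` a strong deformation retract of `U`.  If `x ∈ Hₙ(X, V; M)` has
localisation `0` in `Hₙ(X | Kᵢ; M) = Hₙ(X, X ∖ Kᵢ; M)` for every `i`, then `x = 0`.  (The map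
`Hₙ(X, V) → Hₙ(X, U) = Hₙ(X | ⋃ᵢ Kᵢ)` is injective by the sequence of the triple, and a class
of `Hₙ(X | ⋃ᵢ Kᵢ)` is determined by its restrictions to the `Kᵢ` by Mayer–Vietoris.)
[cite: MilnorHCobordism1965, proof of Thm. 7.6 (PDF p. 50); HatcherAT2002, §2.1 p. 118, §2.2 p. 152] -/
theorem eq_zero_of_forall_localisation_eq_zero {ι : Type*} (K : ι → Set X)
    (hK : ∀ i, IsClosed (K i)) (s : Finset ι) (hdisj : (s : Set ι).PairwiseDisjoint K)
    {V : Set X} (hV : V ⊆ (⋃ i ∈ s, K i)ᶜ) (n : ℕ)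
    (hz : IsZero (relativeSingularHomology R M (↥(⋃ i ∈ s, K i)ᶜ) (Subtype.val ⁻¹' V) n))
    {x : relativeSingularHomology R M X V n}
    (hx : ∀ i (hi : i ∈ s), map R M (ContinuousMap.id X) (mapsTo_id_of_subset
      (hV.trans (Set.compl_subset_compl.2 (Set.subset_biUnion_of_mem hi)))) n x = 0) :
    x = 0 := by
  refine eq_zero_of_map_id_eq_zero R M hV n hz ?_
  refine localHomologyOfSet.eq_zero_of_forall_restrictLocal_eq_zero R M K hK s hdisj _ rfl n _
    fun i hi => ?_
  rw [restrictLocal, ← ModuleCat.comp_apply, ← map_comp]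
  exact hx i hi

/-- The same with the vanishing hypothesis supplied by a **strong deformation retraction of
`X ∖ ⋃ᵢ Kᵢ` onto `V`** (`IsStrongDeformationRetractOf.isZero_relativeSingularHomology`): in
Milnor's setting the complement of the right-hand discs of a slab retracts onto the lower
boundary along the trajectories of the gradient-like field.
[cite: MilnorHCobordism1965, proof of Thm. 7.6 (PDF p. 50); HatcherAT2002, §2.1 p. 118, §2.2 p. 152] -/
theorem eq_zero_of_forall_localisation_eq_zero_of_isStrongDeformationRetractOf {ι : Type*}
    (K : ι → Set X) (hK : ∀ i, IsClosed (K i)) (s : Finset ι)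
    (hdisj : (s : Set ι).PairwiseDisjoint K) {V : Set X} (hV : V ⊆ (⋃ i ∈ s, K i)ᶜ)
    (hsdr : Literature.AlgebraicTopology.Homotopy.IsStrongDeformationRetractOf V (⋃ i ∈ s, K i)ᶜ)
    (n : ℕ) {x : relativeSingularHomology R M X V n}
    (hx : ∀ i (hi : i ∈ s), map R M (ContinuousMap.id X) (mapsTo_id_of_subset
      (hV.trans (Set.compl_subset_compl.2 (Set.subset_biUnion_of_mem hi)))) n x = 0) :
    x = 0 :=
  eq_zero_of_forall_localisation_eq_zero R M K hK s hdisj hV n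
    (hsdr.isZero_relativeSingularHomology R M hV n) hx

end relativeSingularHomology

end Literature.AlgebraicTopology.SingularHomology

end
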